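import Summits.BirchSwinnertonDyer.BirchSwinnertonDyer.Theorems.ThetaPartnerAtTwoMazurTateCongruenceAtTwoRFourFacts
import HarnessLib

/-!
# Crux `MazurTateCongruenceAtTwoTop` (stmt-BirchSwinnertonDyer-25797 = `MazurTateCongruenceAtTwoR` 21416), line `symbol`:
# the `μ`-FREE road — the crux from PUB⁴ + the period fact + «DEPLETION PRESERVES PRIMITIVITY» (an Ihara-type statement),
# with NO `μ = 0` / `μ`-invariance input (lead prover bsd-wall-tp2-p1 g11; `--supports stmt-BirchSwinnertonDyer-25797`; closes nothing)

HONEST FRAMING. THEOREMS ONLY (no `def`, no new named fact, no `sorry`). The named Literature facts and the hypothesis (DP₂) below are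
explicit HYPOTHESES; nothing about their truth is asserted; BSD is not proved by any of this.

THE POINT. The lead's assembly (`mazurTateCongruenceAtTwoTop_of_facts_mu`, p620973; four-fact form
`mazurTateCongruenceAtTwoTop_of_fourFacts_mu`, p622986) derives the crux from PUB⁴ + `HΔ` (a tree theorem) + the symbol statement
`Hμ(E)`: «the expanded `S₀`-depleted plus table `Ψ^{S₀}_E` attains its maximal `2`-adic norm over `ℚ` at SOME rational `x₀` with
`‖2ϖ·Ψ^{S₀}_E(x₀)‖ = 1`». So far `Hμ` was sourced from «`μ = 0` at `2`» ((G′)_N / (PR₂) / FLAT: a unit value AT AN EVEN-LAYER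
`2`-POWER CUSP), which is research. But `Hμ` asks for a unit value at ANY rational, and:
* §1 `symbolMu_of_exists_depletedUnit`: `Hμ(E)` ⟸ «`∃ x₀ ∈ ℚ`, `‖2ϖ·Ψ^{S₀}_E(x₀)‖ = 1`» (every value has norm `≤ 2 = ‖2ϖ‖⁻¹`:
  `norm_ratPlusSymbol_le_two` + integral depletion coefficients `norm_depletedCurveSymbol_le_of_forall_le`);
* §2 `exists_undepletedUnit`: the UNDEPLETED statement holds on the habitat from the period fact alone — the Manin-cusp value `1/2`
  (`exists_ratPlusSymbol_maninCusp_eq_one_half`) has `‖2ϖ·(1/2)‖ = ‖ϖ‖ = 1`;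
* §3 so the crux follows from PUB⁴ + the period fact + **(DP₂) «depletion at odd places preserves primitivity mod 2»**: for `E` good
  supersingular at `2` with `a₂ = 0`, newform `f`, Néron ratio `ϖ`, admissible `S₀`: if `2ϖ[·]⁺_f` takes a `2`-adic unit value on `ℚ`,
  so does `2ϖ·Ψ^{S₀}_E` (`mazurTateCongruenceAtTwoTop_of_fourFacts_depletionPrimitive`; also the coarser `…_of_fourFacts_depletedUnit`).
  (DP₂) is an IHARA-TYPE statement (Ribet's lemma «the kernel of `J₀(N)² → J₀(Nℓ)` is Eisenstein», Serre's congruence-subgroup property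
  for `SL₂(ℤ[1/ℓ])`): if one depletion step killed the symbol mod `𝔪`, §4 shows the symbol would be `ℤ[1/ℓ]`-translation invariant
  mod `𝔪`, i.e. (with its `Γ₀(N')`-modularity) invariant under the `ℓ`-arithmetic group `Γ₀(N')^{(ℓ)}`, which for a non-Eisenstein
  mod-`2` Hecke eigen-system (`E[2]` irreducible) forces it to vanish — Ihara's lemma in symbol form. Its inputs are printed
  theorems (Ribet's lemma, Serre's CSP, Chebotarev); the derivation of (DP₂) from them is the lead's argument (memo
  `Cruxes/MazurTateCongruenceAtTwoTop/K1ROW-LEAD-g11.md`), not a printed statement; nothing is asserted about (DP₂) here. `μ`-free.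
* §4 `norm_sub_lt_one_of_depletion` — the translation lemma (pure ultrametric algebra): if `Φ : ℚ → ℚ̄₂` is `1`-periodic and
  `‖Φ(r) + c₁Φ(ℓr) + c₂Φ(ℓ²r)‖ < 1` for all `r` (`‖c₁‖, ‖c₂‖ ≤ 1`), then `‖Φ(r + j/ℓⁿ) − Φ(r)‖ < 1` for all `r, j, n`.
* §5 (DP₂) is implied by each «`μ = 0`» currency (`depletionPrimitive_of_symbolMu`), so nothing is lost.

References: [Ribet1984ICM] K. Ribet, Congruence relations between modular forms, Proc. ICM 1983, Thm. 4.1–4.3; [Serre1970SL2] J.-P. Serre,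
Le problème des groupes de congruence pour SL₂, Ann. Math. 92, Thm. 2 and §II.1.4 of *Trees*; [Diamond1991CongruencePrimes] F. Diamond, Congruence primes
for cusp forms of weight k ≥ 2, Astérisque 196–197, Thm. 2; [GreenbergVatsal2000] §3 Remark 3.4, (13); [Vatsal1999] Thm. (1.10);
[AbbesUllmo1996] Thm. A; [Manin1972] Thm. 1.9.
-/

-- justification: the `Summit.BirchSwinnertonDyer.BirchSwinnertonDyer.…` path repeats a component (route-file convention)
set_option linter.dupNamespace false
set_option autoImplicit false

noncomputable section

open scoped Classical MatrixGroups ModularForm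

open CongruenceSubgroup Polynomial WeierstrassCurve NumberField IsDedekindDomain
  Literature.NumberTheory.IwasawaTheory Literature.NumberTheory.EllipticCurves Literature.NumberTheory.EllipticCurves.ModularForms
  Literature.NumberTheory.EllipticCurves.Rank1Residual Literature.NumberTheory.EllipticCurves.GreenbergVatsal2000
  Literature.NumberTheory.EllipticCurves.Sprung2017
  Summit.BirchSwinnertonDyer.Rank1Residual.Supersingular
  Summit.BirchSwinnertonDyer.BirchSwinnertonDyer.Theorems.ThetaLayerLambdaCongruenceAtTwo

namespace Summit.BirchSwinnertonDyer.BirchSwinnertonDyer.Theorems.MazurTateCongruenceAtTwoR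

/-! ## §1. `Hμ(E)` from ONE unit value of the depleted table, anywhere on `ℚ` -/

section DepletedUnit

variable (E : WeierstrassCurve ℚ) [E.IsElliptic] [E.IsGloballyMinimal]

/-- **`Hμ(E)` ⟸ a unit value anywhere.** For a globally minimal elliptic `E` good supersingular at `2` with `a₂(E) = 0`, its newform `f`,
`ϖ` with `ϖ·Ω_E = Ω⁺_f`, and a finite set `S₀` of odd places: granted the period fact (so `‖ϖ‖₂ = 1`), if the doubled Néron-normalised
expanded `S₀`-depleted plus table takes a `2`-adic UNIT value at some rational `x₀`, then `Hμ(E)` holds with that `x₀` — every value of the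
table has norm `≤ 2` (all values of `[·]⁺_f` have norm `≤ 2`, `norm_ratPlusSymbol_le_two`; the depletion coefficients are `2`-integral,
`norm_depletedCurveSymbol_le_of_forall_le`), and `‖Ψ(x₀)‖ = ‖2ϖ‖⁻¹ = 2`. [cite: Manin1972, Thm. 1.9] [cite: GreenbergVatsal2000, §3, Remark 3.4] -/
theorem symbolMu_of_exists_depletedUnit (h2 : realPeriodRat_eq_unit_mul_plusPeriod_two) (hss : GoodSS E 2)
    (ha : E.frobeniusTrace 2 = 0) [NeZero (E.conductorNorm ℤ)] {f : CuspForm (Gamma0 (E.conductorNorm ℤ)) 2} (hf : IsNewformOf E f)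
    {ϖ : ℚ} (hϖ : (ϖ : ℝ) * E.realPeriodRat = plusPeriod f)
    (S₀ : Finset (HeightOneSpectrum (𝓞 ℚ))) (hS2 : ∀ v ∈ S₀, ((2 : ℕ) : 𝓞 ℚ) ∉ v.asIdeal)
    (hx : ∃ x₀ : ℚ, ‖algebraMap ℚ (PadicAlgCl 2) (2 * ϖ) * (∑ k ∈ Fintype.piFinset (fun _ : S₀ ↦ Finset.range 3), (∏ v : S₀, ((E.localPolynomialAt (v : HeightOneSpectrum (𝓞 ℚ))).map (Int.castRingHom (PadicAlgCl 2))).coeff (k v) * ((Rat.HeightOneSpectrum.natGenerator (v : HeightOneSpectrum (𝓞 ℚ)) : PadicAlgCl 2)⁻¹) ^ (k v)) * algebraMap ℚ (PadicAlgCl 2) (ratPlusSymbol f (x₀ * ((∏ v : S₀, Rat.HeightOneSpectrum.natGenerator (v : HeightOneSpectrum (𝓞 ℚ)) ^ (k v) : ℕ) : ℚ))))‖ = 1) :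
    ∃ x₀ : ℚ, (∀ r : ℚ, ‖(∑ k ∈ Fintype.piFinset (fun _ : S₀ ↦ Finset.range 3), (∏ v : S₀, ((E.localPolynomialAt (v : HeightOneSpectrum (𝓞 ℚ))).map (Int.castRingHom (PadicAlgCl 2))).coeff (k v) * ((Rat.HeightOneSpectrum.natGenerator (v : HeightOneSpectrum (𝓞 ℚ)) : PadicAlgCl 2)⁻¹) ^ (k v)) * algebraMap ℚ (PadicAlgCl 2) (ratPlusSymbol f (r * ((∏ v : S₀, Rat.HeightOneSpectrum.natGenerator (v : HeightOneSpectrum (𝓞 ℚ)) ^ (k v) : ℕ) : ℚ))))‖ ≤ ‖(∑ k ∈ Fintype.piFinset (fun _ : S₀ ↦ Finset.range 3), (∏ v : S₀, ((E.localPolynomialAt (v : HeightOneSpectrum (𝓞 ℚ))).map (Int.castRingHom (PadicAlgCl 2))).coeff (k v) * ((Rat.HeightOneSpectrum.natGenerator (v : HeightOneSpectrum (𝓞 ℚ)) : PadicAlgCl 2)⁻¹) ^ (k v)) * algebraMap ℚ (PadicAlgCl 2) (ratPlusSymbol f (x₀ * ((∏ v : S₀, Rat.HeightOneSpectrum.natGenerator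 (v : HeightOneSpectrum (𝓞 ℚ)) ^ (k v) : ℕ) : ℚ))))‖) ∧
      ‖algebraMap ℚ (PadicAlgCl 2) (2 * ϖ) * (∑ k ∈ Fintype.piFinset (fun _ : S₀ ↦ Finset.range 3), (∏ v : S₀, ((E.localPolynomialAt (v : HeightOneSpectrum (𝓞 ℚ))).map (Int.castRingHom (PadicAlgCl 2))).coeff (k v) * ((Rat.HeightOneSpectrum.natGenerator (v : HeightOneSpectrum (𝓞 ℚ)) : PadicAlgCl 2)⁻¹) ^ (k v)) * algebraMap ℚ (PadicAlgCl 2) (ratPlusSymbol f (x₀ * ((∏ v : S₀, Rat.HeightOneSpectrum.natGenerator (v : HeightOneSpectrum (𝓞 ℚ)) ^ (k v) : ℕ) : ℚ))))‖ = 1 := by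
  obtain ⟨x₀, hx₀⟩ := hx
  -- `‖2ϖ‖ = 2⁻¹`
  have h2ϖ : ‖algebraMap ℚ (PadicAlgCl 2) (2 * ϖ)‖ = 2⁻¹ := by
    rw [map_mul, norm_mul, map_ofNat, ResidualThetaLayer.norm_two_padicAlgCl, norm_algebraMap_rat_eq_norm_ratCast_padic,
      norm_ratCast_periodRatio_eq_one_two h2 E hss hf hϖ, mul_one]
  -- hence the value at `x₀` has norm `2`
  have hV : ‖(∑ k ∈ Fintype.piFinset (fun _ : S₀ ↦ Finset.range 3), (∏ v : S₀, ((E.localPolynomialAt (v : HeightOneSpectrum (𝓞 ℚ))).map (Int.castRingHom (PadicAlgCl 2))).coeff (k v) * ((Rat.HeightOneSpectrum.natGenerator (v : HeightOneSpectrum (𝓞 ℚ)) : PadicAlgCl 2)⁻¹) ^ (k v)) * algebraMap ℚ (PadicAlgCl 2) (ratPlusSymbol f (x₀ * ((∏ v : S₀, Rat.HeightOneSpectrum.natGenerator (v : HeightOneSpectrum (𝓞 ℚ)) ^ (k v) : ℕ) : ℚ))))‖ = 2 := by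
    have h := hx₀
    rw [norm_mul, h2ϖ] at h
    have h' : ‖(∑ k ∈ Fintype.piFinset (fun _ : S₀ ↦ Finset.range 3), (∏ v : S₀, ((E.localPolynomialAt (v : HeightOneSpectrum (𝓞 ℚ))).map (Int.castRingHom (PadicAlgCl 2))).coeff (k v) * ((Rat.HeightOneSpectrum.natGenerator (v : HeightOneSpectrum (𝓞 ℚ)) : PadicAlgCl 2)⁻¹) ^ (k v)) * algebraMap ℚ (PadicAlgCl 2) (ratPlusSymbol f (x₀ * ((∏ v : S₀, Rat.HeightOneSpectrum.natGenerator (v : HeightOneSpectrum (𝓞 ℚ)) ^ (k v) : ℕ) : ℚ))))‖ = 2 * (2⁻¹ * ‖(∑ k ∈ Fintype.piFinset (fun _ : S₀ ↦ Finset.range 3), (∏ v : S₀, ((E.localPolynomialAt (v : HeightOneSpectrum (𝓞 ℚ))).map (Int.castRingHom (PadicAlgCl 2))).coeff (k v) * ((Rat.HeightOneSpectrum.natGenerator (v : HeightOneSpectrum (𝓞 ℚ)) : PadicAlgCl 2)⁻¹) ^ (k v)) * algebraMap ℚ (PadicAlgCl 2) (ratPlusSymbol f (x₀ * ((∏ v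 : S₀, Rat.HeightOneSpectrum.natGenerator (v : HeightOneSpectrum (𝓞 ℚ)) ^ (k v) : ℕ) : ℚ))))‖) := by ring
    rw [h', h, mul_one]
  refine ⟨x₀, fun r ↦ ?_, hx₀⟩
  rw [hV]
  exact norm_depletedCurveSymbol_le_of_forall_le E f S₀ hS2 (norm_ratPlusSymbol_le_two hf hss ha) r

end DepletedUnit

/-! ## §2. The undepleted statement holds: the Manin-cusp value `1/2` -/

section Undepleted

variable (E : WeierstrassCurve ℚ) [E.IsElliptic] [E.IsGloballyMinimal]

/-- **The Néron-normalised plus symbol is primitive at `2` (undepleted).** For `E` good supersingular at `2`, newform `f`, `ϖ·Ω_E = Ω⁺_f`: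
granted the period fact, `2ϖ[r]⁺_f` is a `2`-adic unit at the Manin cusp `r = γ0` where `[γ0]⁺_f = 1/2`
(`exists_ratPlusSymbol_maninCusp_eq_one_half`): `‖2ϖ·½‖ = ‖ϖ‖ = 1`. [cite: Manin1972, Thm. 1.9] [cite: AbbesUllmo1996, Thm. A]
[cite: GreenbergVatsal2000, §3, Remark 3.4] -/
theorem exists_undepletedUnit (h2 : realPeriodRat_eq_unit_mul_plusPeriod_two) (hss : GoodSS E 2)
    [NeZero (E.conductorNorm ℤ)] {f : CuspForm (Gamma0 (E.conductorNorm ℤ)) 2} (hf : IsNewformOf E f)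
    {ϖ : ℚ} (hϖ : (ϖ : ℝ) * E.realPeriodRat = plusPeriod f) :
    ∃ r : ℚ, ‖algebraMap ℚ (PadicAlgCl 2) (2 * ϖ) * algebraMap ℚ (PadicAlgCl 2) (ratPlusSymbol f r)‖ = 1 := by
  obtain ⟨γ, -, hγ⟩ := exists_ratPlusSymbol_maninCusp_eq_one_half f hf.1 hf.coeffField_eq_bot
  refine ⟨(((γ : SL(2, ℤ)) 0 0 : ℚ)) / (((γ : SL(2, ℤ)) 1 0 : ℚ)), ?_⟩
  rw [hγ, ← map_mul, show (2 * ϖ * (1 / 2) : ℚ) = ϖ by ring, norm_algebraMap_rat_eq_norm_ratCast_padic]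
  exact norm_ratCast_periodRatio_eq_one_two h2 E hss hf hϖ

end Undepleted

/-! ## §3. THE CRUX BY NAME from PUB⁴ + the period fact + «depletion preserves primitivity» -/

section Crux

/-- **`MazurTateCongruenceAtTwoTop` BY NAME from PUB⁴ + the period fact + (DU₂) «a depleted unit value».** Granted the four named facts
of the plus line, `realPeriodRat_eq_unit_mul_plusPeriod_two`, and (DU₂): for every globally minimal `E` good supersingular at `2` with
`a₂(E) = 0`, newform `f`, Néron ratio `ϖ` and admissible `S₀`, the doubled Néron-normalised expanded `S₀`-depleted plus table takes a
`2`-adic unit value at SOME rational — the crux holds (`HΔ` := `habitatNegDisc`, `Hμ` := §1). No `μ = 0` / `μ`-invariance input.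
BSD is not proved by this. [cite: GreenbergVatsal2000, Thm. (1.4), §3 (13)] [cite: Vatsal1999, Thm. (1.10)] [cite: Buzzard2000LevelLoweringModTwo, Prop. 2.4] -/
theorem mazurTateCongruenceAtTwoTop_of_fourFacts_depletedUnit
    (hES : eichlerShimura_depletedOptimalQuotient_periodLattice_of_dvd) (hSD : heckeSelfDual_torsionBy_J0)
    (hBz : buzzard2000_multiplicityOne_gamma0) (hSe : serre1972_supersingular_decompositionSubgroup_image)
    (h2 : realPeriodRat_eq_unit_mul_plusPeriod_two)
    (hDU : ∀ (E : WeierstrassCurve ℚ) [E.IsElliptic] [E.IsGloballyMinimal], GoodSS E 2 → E.frobeniusTrace 2 = 0 →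
      ∀ [NeZero (E.conductorNorm ℤ)] (f : CuspForm (Gamma0 (E.conductorNorm ℤ)) 2), IsNewformOf E f →
      ∀ (ϖ : ℚ), (ϖ : ℝ) * E.realPeriodRat = plusPeriod f →
      ∀ (S₀ : Finset (HeightOneSpectrum (𝓞 ℚ))), (∀ v ∈ S₀, ((2 : ℕ) : 𝓞 ℚ) ∉ v.asIdeal) →
        (∀ v : HeightOneSpectrum (𝓞 ℚ), ¬ E.HasGoodReductionAt v → v ∈ S₀) →
      ∃ x₀ : ℚ, ‖algebraMap ℚ (PadicAlgCl 2) (2 * ϖ) * (∑ k ∈ Fintype.piFinset (fun _ : S₀ ↦ Finset.range 3), (∏ v : S₀, ((E.localPolynomialAt (v : HeightOneSpectrum (𝓞 ℚ))).map (Int.castRingHom (PadicAlgCl 2))).coeff (k v) * ((Rat.HeightOneSpectrum.natGenerator (v : HeightOneSpectrum (𝓞 ℚ)) : PadicAlgCl 2)⁻¹) ^ (k v)) * algebraMap ℚ (PadicAlgCl 2) (ratPlusSymbol f (x₀ * ((∏ v : S₀, Rat.HeightOneSpectrum.natGenerator (v : HeightOneSpectrum (𝓞 ℚ)) ^ (k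 v) : ℕ) : ℚ))))‖ = 1) :
    Summit.BirchSwinnertonDyer.BirchSwinnertonDyer.Theses.ThetaPartnerAtTwo.MazurTateCongruenceAtTwoTop := by
  refine mazurTateCongruenceAtTwoTop_of_fourFacts_mu hES hSD hBz hSe ?_
  intro E _ _ hss ha _ f hf ϖ hϖ S₀ hS2 hSE
  exact symbolMu_of_exists_depletedUnit E h2 hss ha hf hϖ S₀ hS2 (hDU E hss ha f hf ϖ hϖ S₀ hS2 hSE)

/-- **`MazurTateCongruenceAtTwoTop` BY NAME from PUB⁴ + the period fact + (DP₂) «depletion preserves primitivity mod `2`».** Granted the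
four named facts, the period fact, and (DP₂): for every globally minimal `E` good supersingular at `2` with `a₂(E) = 0`, newform `f`, Néron
ratio `ϖ` and admissible `S₀` — IF `2ϖ[·]⁺_f` takes a `2`-adic unit value on `ℚ` THEN so does `2ϖ·Ψ^{S₀}_E` — the crux holds; the
undepleted unit value is §2. (DP₂) is an Ihara-type statement (module docstring; §4 is its first step); `μ`-free; nothing asserted.
BSD is not proved by this. [cite: Ribet1984ICM, Thm. 4.1] [cite: Serre1970SL2, Thm. 2] [cite: GreenbergVatsal2000, §3 (13) and Remark 3.4] -/
theorem mazurTateCongruenceAtTwoTop_of_fourFacts_depletionPrimitive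
    (hES : eichlerShimura_depletedOptimalQuotient_periodLattice_of_dvd) (hSD : heckeSelfDual_torsionBy_J0)
    (hBz : buzzard2000_multiplicityOne_gamma0) (hSe : serre1972_supersingular_decompositionSubgroup_image)
    (h2 : realPeriodRat_eq_unit_mul_plusPeriod_two)
    (hDP : ∀ (E : WeierstrassCurve ℚ) [E.IsElliptic] [E.IsGloballyMinimal], GoodSS E 2 → E.frobeniusTrace 2 = 0 →
      ∀ [NeZero (E.conductorNorm ℤ)] (f : CuspForm (Gamma0 (E.conductorNorm ℤ)) 2), IsNewformOf E f →
      ∀ (ϖ : ℚ), (ϖ : ℝ) * E.realPeriodRat = plusPeriod f →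
      ∀ (S₀ : Finset (HeightOneSpectrum (𝓞 ℚ))), (∀ v ∈ S₀, ((2 : ℕ) : 𝓞 ℚ) ∉ v.asIdeal) →
        (∀ v : HeightOneSpectrum (𝓞 ℚ), ¬ E.HasGoodReductionAt v → v ∈ S₀) →
      (∃ r : ℚ, ‖algebraMap ℚ (PadicAlgCl 2) (2 * ϖ) * algebraMap ℚ (PadicAlgCl 2) (ratPlusSymbol f r)‖ = 1) →
      ∃ x₀ : ℚ, ‖algebraMap ℚ (PadicAlgCl 2) (2 * ϖ) * (∑ k ∈ Fintype.piFinset (fun _ : S₀ ↦ Finset.range 3), (∏ v : S₀, ((E.localPolynomialAt (v : HeightOneSpectrum (𝓞 ℚ))).map (Int.castRingHom (PadicAlgCl 2))).coeff (k v) * ((Rat.HeightOneSpectrum.natGenerator (v : HeightOneSpectrum (𝓞 ℚ)) : PadicAlgCl 2)⁻¹) ^ (k v)) * algebraMap ℚ (PadicAlgCl 2) (ratPlusSymbol f (x₀ * ((∏ v : S₀, Rat.HeightOneSpectrum.natGenerator (v : HeightOneSpectrum (𝓞 ℚ)) ^ (k v) : ℕ) : ℚ))))‖ = 1) :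
    Summit.BirchSwinnertonDyer.BirchSwinnertonDyer.Theses.ThetaPartnerAtTwo.MazurTateCongruenceAtTwoTop := by
  refine mazurTateCongruenceAtTwoTop_of_fourFacts_depletedUnit hES hSD hBz hSe h2 ?_
  intro E _ _ hss ha _ f hf ϖ hϖ S₀ hS2 hSE
  exact hDP E hss ha f hf ϖ hϖ S₀ hS2 hSE (exists_undepletedUnit E h2 hss hf hϖ)

/-- **PUB⁵ form** (period fact from Abbes–Ullmo Thm. A): the crux BY NAME from Eichler–Shimura (depleted optimal quotient), Hecke
self-duality, Buzzard, Serre 1972, Abbes–Ullmo, and (DP₂). BSD is not proved by this. [cite: AbbesUllmo1996, Thm. A] [cite: Ribet1984ICM, Thm. 4.1] -/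
theorem mazurTateCongruenceAtTwoTop_of_fiveFacts_depletionPrimitive
    (hES : eichlerShimura_depletedOptimalQuotient_periodLattice_of_dvd) (hSD : heckeSelfDual_torsionBy_J0)
    (hBz : buzzard2000_multiplicityOne_gamma0) (hSe : serre1972_supersingular_decompositionSubgroup_image)
    (hAU : abbesUllmo_not_dvd_maninConstant_of_not_dvd_level)
    (hDP : ∀ (E : WeierstrassCurve ℚ) [E.IsElliptic] [E.IsGloballyMinimal], GoodSS E 2 → E.frobeniusTrace 2 = 0 →
      ∀ [NeZero (E.conductorNorm ℤ)] (f : CuspForm (Gamma0 (E.conductorNorm ℤ)) 2), IsNewformOf E f →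
      ∀ (ϖ : ℚ), (ϖ : ℝ) * E.realPeriodRat = plusPeriod f →
      ∀ (S₀ : Finset (HeightOneSpectrum (𝓞 ℚ))), (∀ v ∈ S₀, ((2 : ℕ) : 𝓞 ℚ) ∉ v.asIdeal) →
        (∀ v : HeightOneSpectrum (𝓞 ℚ), ¬ E.HasGoodReductionAt v → v ∈ S₀) →
      (∃ r : ℚ, ‖algebraMap ℚ (PadicAlgCl 2) (2 * ϖ) * algebraMap ℚ (PadicAlgCl 2) (ratPlusSymbol f r)‖ = 1) →
      ∃ x₀ : ℚ, ‖algebraMap ℚ (PadicAlgCl 2) (2 * ϖ) * (∑ k ∈ Fintype.piFinset (fun _ : S₀ ↦ Finset.range 3), (∏ v : S₀, ((E.localPolynomialAt (v : HeightOneSpectrum (𝓞 ℚ))).map (Int.castRingHom (PadicAlgCl 2))).coeff (k v) * ((Rat.HeightOneSpectrum.natGenerator (v : HeightOneSpectrum (𝓞 ℚ)) : PadicAlgCl 2)⁻¹) ^ (k v)) * algebraMap ℚ (PadicAlgCl 2) (ratPlusSymbol f (x₀ * ((∏ v : S₀, Rat.HeightOneSpectrum.natGenerator (v : HeightOneSpectrum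 (𝓞 ℚ)) ^ (k v) : ℕ) : ℚ))))‖ = 1) :
    Summit.BirchSwinnertonDyer.BirchSwinnertonDyer.Theses.ThetaPartnerAtTwo.MazurTateCongruenceAtTwoTop :=
  mazurTateCongruenceAtTwoTop_of_fourFacts_depletionPrimitive hES hSD hBz hSe
    (SkinnerUrban2014.realPeriodRat_eq_unit_mul_plusPeriod_two_fact_of_abbesUllmo hAU) hDP

/-- The twin `MazurTateCongruenceAtTwoR` (stmt-21416) BY NAME from PUB⁴ + the period fact + (DP₂). BSD is not proved by this.
[cite: Ribet1984ICM, Thm. 4.1] [cite: GreenbergVatsal2000, §3 (13)] -/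
theorem mazurTateCongruenceAtTwoR_of_fourFacts_depletionPrimitive
    (hES : eichlerShimura_depletedOptimalQuotient_periodLattice_of_dvd) (hSD : heckeSelfDual_torsionBy_J0)
    (hBz : buzzard2000_multiplicityOne_gamma0) (hSe : serre1972_supersingular_decompositionSubgroup_image)
    (h2 : realPeriodRat_eq_unit_mul_plusPeriod_two)
    (hDP : ∀ (E : WeierstrassCurve ℚ) [E.IsElliptic] [E.IsGloballyMinimal], GoodSS E 2 → E.frobeniusTrace 2 = 0 →
      ∀ [NeZero (E.conductorNorm ℤ)] (f : CuspForm (Gamma0 (E.conductorNorm ℤ)) 2), IsNewformOf E f →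
      ∀ (ϖ : ℚ), (ϖ : ℝ) * E.realPeriodRat = plusPeriod f →
      ∀ (S₀ : Finset (HeightOneSpectrum (𝓞 ℚ))), (∀ v ∈ S₀, ((2 : ℕ) : 𝓞 ℚ) ∉ v.asIdeal) →
        (∀ v : HeightOneSpectrum (𝓞 ℚ), ¬ E.HasGoodReductionAt v → v ∈ S₀) →
      (∃ r : ℚ, ‖algebraMap ℚ (PadicAlgCl 2) (2 * ϖ) * algebraMap ℚ (PadicAlgCl 2) (ratPlusSymbol f r)‖ = 1) →
      ∃ x₀ : ℚ, ‖algebraMap ℚ (PadicAlgCl 2) (2 * ϖ) * (∑ k ∈ Fintype.piFinset (fun _ : S₀ ↦ Finset.range 3), (∏ v : S₀, ((E.localPolynomialAt (v : HeightOneSpectrum (𝓞 ℚ))).map (Int.castRingHom (PadicAlgCl 2))).coeff (k v) * ((Rat.HeightOneSpectrum.natGenerator (v : HeightOneSpectrum (𝓞 ℚ)) : PadicAlgCl 2)⁻¹) ^ (k v)) * algebraMap ℚ (PadicAlgCl 2) (ratPlusSymbol f (x₀ * ((∏ v : S₀, Rat.HeightOneSpectrum.natGenerator (v : HeightOneSpectrum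 (𝓞 ℚ)) ^ (k v) : ℕ) : ℚ))))‖ = 1) :
    Summit.BirchSwinnertonDyer.BirchSwinnertonDyer.Theses.ThetaPartnerAtTwo.MazurTateCongruenceAtTwoR :=
  mazurTateCongruenceAtTwoTop_of_fourFacts_depletionPrimitive hES hSD hBz hSe h2 hDP

end Crux

/-! ## §4. The translation lemma: a vanishing depletion step makes the symbol `ℤ[1/ℓ]`-periodic (mod `𝔪`) -/

section Translation

variable {K : Type*} [NormedField K] [IsUltrametricDist K]

/-- `‖a − b‖ ≤ max ‖a‖ ‖b‖` in an ultrametric normed field. [folklore] -/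
private theorem norm_sub_le_max' (a b : K) : ‖a - b‖ ≤ max ‖a‖ ‖b‖ := by
  rw [sub_eq_add_neg, ← norm_neg b]
  exact IsUltrametricDist.norm_add_le_max a (-b)

/-- One induction step of the translation lemma, packaged: if `‖Φ(s + x) − Φ(s)‖ < 1` for the two inner shifts then the outer shift is
congruent too. (Ultrametric bookkeeping.) [folklore] -/
theorem norm_sub_lt_one_of_depletion_step {Φ : ℚ → K} {c₁ c₂ : K} (hc₁ : ‖c₁‖ ≤ 1) (hc₂ : ‖c₂‖ ≤ 1) {ℓ : ℚ}
    (hD : ∀ r : ℚ, ‖Φ r + c₁ * Φ (ℓ * r) + c₂ * Φ (ℓ ^ 2 * r)‖ < 1) {r x : ℚ}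
    (h₁ : ‖Φ (ℓ * r + ℓ * x) - Φ (ℓ * r)‖ < 1) (h₂ : ‖Φ (ℓ ^ 2 * r + ℓ ^ 2 * x) - Φ (ℓ ^ 2 * r)‖ < 1) :
    ‖Φ (r + x) - Φ r‖ < 1 := by
  have hkey : Φ (r + x) - Φ r = (Φ (r + x) + c₁ * Φ (ℓ * (r + x)) + c₂ * Φ (ℓ ^ 2 * (r + x))) -
      (Φ r + c₁ * Φ (ℓ * r) + c₂ * Φ (ℓ ^ 2 * r)) -
      (c₁ * (Φ (ℓ * r + ℓ * x) - Φ (ℓ * r)) + c₂ * (Φ (ℓ ^ 2 * r + ℓ ^ 2 * x) - Φ (ℓ ^ 2 * r))) := by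
    rw [mul_add ℓ r x, mul_add (ℓ ^ 2) r x]; ring
  rw [hkey]
  refine (norm_sub_le_max' _ _).trans_lt (max_lt ?_ ?_)
  · exact (norm_sub_le_max' _ _).trans_lt (max_lt (hD _) (hD _))
  · refine (IsUltrametricDist.norm_add_le_max _ _).trans_lt (max_lt ?_ ?_)
    · rw [norm_mul]; exact (mul_le_of_le_one_left (norm_nonneg _) hc₁).trans_lt h₁
    · rw [norm_mul]; exact (mul_le_of_le_one_left (norm_nonneg _) hc₂).trans_lt h₂

/-- **Translation lemma.** Let `Φ : ℚ → K` (`K` an ultrametric normed field, e.g. `ℚ̄₂`) be `1`-periodic, `ℓ` a non-zero integer, and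
`c₁, c₂` of norm `≤ 1`. If the depletion step `r ↦ Φ(r) + c₁Φ(ℓr) + c₂Φ(ℓ²r)` is everywhere of norm `< 1`, then `Φ` is
`ℤ[1/ℓ]`-translation invariant modulo the maximal ideal: `‖Φ(r + j/ℓⁿ) − Φ(r)‖ < 1` for all `r ∈ ℚ`, `j ∈ ℤ`, `n ∈ ℕ`. (Induction on `n`
two steps at a time: the shifts `ℓ·j/ℓⁿ⁺²`, `ℓ²·j/ℓⁿ⁺²` are the previous two cases.) This is the first step of the Ihara argument behind
(DP₂): a vanishing depletion would make the mod-`𝔪` symbol invariant under `Γ₀(N')` AND all of `ℤ[1/ℓ]`, i.e. under `Γ₀(N')^{(ℓ)}`.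
[cite: Ribet1984ICM, Thm. 4.1 (proof)] -/
theorem norm_sub_lt_one_of_depletion {Φ : ℚ → K} (h1 : ∀ (r : ℚ) (z : ℤ), Φ (r + z) = Φ r) {c₁ c₂ : K} (hc₁ : ‖c₁‖ ≤ 1)
    (hc₂ : ‖c₂‖ ≤ 1) {ℓ : ℤ} (hℓ : ℓ ≠ 0) (hD : ∀ r : ℚ, ‖Φ r + c₁ * Φ (ℓ * r) + c₂ * Φ ((ℓ : ℚ) ^ 2 * r)‖ < 1)
    (n : ℕ) (r : ℚ) (j : ℤ) : ‖Φ (r + j / (ℓ : ℚ) ^ n) - Φ r‖ < 1 := by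
  have hℓ' : (ℓ : ℚ) ≠ 0 := Int.cast_ne_zero.mpr hℓ
  -- integer shifts are invisible
  have h0 : ∀ (s : ℚ) (z : ℤ), ‖Φ (s + z) - Φ s‖ < 1 := fun s z ↦ by rw [h1, sub_self, norm_zero]; exact one_pos
  -- two consecutive cases at once
  suffices H : ∀ m : ℕ, (∀ (s : ℚ) (i : ℤ), ‖Φ (s + i / (ℓ : ℚ) ^ m) - Φ s‖ < 1) ∧
      (∀ (s : ℚ) (i : ℤ), ‖Φ (s + i / (ℓ : ℚ) ^ (m + 1)) - Φ s‖ < 1) from (H n).1 r j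
  intro m
  induction m with
  | zero =>
    refine ⟨fun s i ↦ by simpa using h0 s i, fun s i ↦ ?_⟩
    -- shift `i/ℓ`: the inner shifts are the integers `i` and `ℓ i`
    refine norm_sub_lt_one_of_depletion_step hc₁ hc₂ hD ?_ ?_
    · have : (ℓ : ℚ) * (i / (ℓ : ℚ) ^ (0 + 1)) = ((i : ℤ) : ℚ) := by field_simp; ring
      rw [this]; exact h0 _ _
    · have : (ℓ : ℚ) ^ 2 * (i / (ℓ : ℚ) ^ (0 + 1)) = ((ℓ * i : ℤ) : ℚ) := by push_cast; field_simp
      rw [this]; exact h0 _ _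
  | succ m ih =>
    refine ⟨ih.2, fun s i ↦ norm_sub_lt_one_of_depletion_step hc₁ hc₂ hD ?_ ?_⟩
    · have : (ℓ : ℚ) * (i / (ℓ : ℚ) ^ (m + 1 + 1)) = i / (ℓ : ℚ) ^ (m + 1) := by field_simp; ring
      rw [this]; exact ih.2 _ _
    · have : (ℓ : ℚ) ^ 2 * (i / (ℓ : ℚ) ^ (m + 1 + 1)) = i / (ℓ : ℚ) ^ m := by field_simp; ring
      rw [this]; exact ih.1 _ _

end Translation

/-! ## §5. (DP₂) is implied by the line's earlier «`μ = 0`» inputs -/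

section Compare

/-- **`Hμ` ⟹ (DU₂)**: the symbol-`μ` statement `Hμ(E)` (a point of maximal norm with unit doubled value) trivially gives a depleted unit
value; so the `μ`-free hypothesis (DU₂) of `mazurTateCongruenceAtTwoTop_of_fourFacts_depletedUnit` is at most as strong as `Hμ`, hence as
each of (G′)_N / (PR₂) / FLAT. [cite: Pollack2003, Conj. 6.3] -/
theorem depletedUnit_of_symbolMu
    (Hμ : ∀ (E : WeierstrassCurve ℚ) [E.IsElliptic] [E.IsGloballyMinimal], GoodSS E 2 → E.frobeniusTrace 2 = 0 →
      ∀ [NeZero (E.conductorNorm ℤ)] (f : CuspForm (Gamma0 (E.conductorNorm ℤ)) 2), IsNewformOf E f →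
      ∀ (ϖ : ℚ), (ϖ : ℝ) * E.realPeriodRat = plusPeriod f →
      ∀ (S₀ : Finset (HeightOneSpectrum (𝓞 ℚ))), (∀ v ∈ S₀, ((2 : ℕ) : 𝓞 ℚ) ∉ v.asIdeal) →
        (∀ v : HeightOneSpectrum (𝓞 ℚ), ¬ E.HasGoodReductionAt v → v ∈ S₀) →
      ∃ x₀ : ℚ, (∀ r : ℚ, ‖(∑ k ∈ Fintype.piFinset (fun _ : S₀ ↦ Finset.range 3), (∏ v : S₀, ((E.localPolynomialAt (v : HeightOneSpectrum (𝓞 ℚ))).map (Int.castRingHom (PadicAlgCl 2))).coeff (k v) * ((Rat.HeightOneSpectrum.natGenerator (v : HeightOneSpectrum (𝓞 ℚ)) : PadicAlgCl 2)⁻¹) ^ (k v)) * algebraMap ℚ (PadicAlgCl 2) (ratPlusSymbol f (r * ((∏ v : S₀, Rat.HeightOneSpectrum.natGenerator (v : HeightOneSpectrum (𝓞 ℚ)) ^ (k v) : ℕ) : ℚ))))‖ ≤ ‖(∑ k ∈ Fintype.piFinset (fun _ : S₀ ↦ Finset.range 3), (∏ v : S₀, ((E.localPolynomialAt (v : HeightOneSpectrum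 (𝓞 ℚ))).map (Int.castRingHom (PadicAlgCl 2))).coeff (k v) * ((Rat.HeightOneSpectrum.natGenerator (v : HeightOneSpectrum (𝓞 ℚ)) : PadicAlgCl 2)⁻¹) ^ (k v)) * algebraMap ℚ (PadicAlgCl 2) (ratPlusSymbol f (x₀ * ((∏ v : S₀, Rat.HeightOneSpectrum.natGenerator (v : HeightOneSpectrum (𝓞 ℚ)) ^ (k v) : ℕ) : ℚ))))‖) ∧
        ‖algebraMap ℚ (PadicAlgCl 2) (2 * ϖ) * (∑ k ∈ Fintype.piFinset (fun _ : S₀ ↦ Finset.range 3), (∏ v : S₀, ((E.localPolynomialAt (v : HeightOneSpectrum (𝓞 ℚ))).map (Int.castRingHom (PadicAlgCl 2))).coeff (k v) * ((Rat.HeightOneSpectrum.natGenerator (v : HeightOneSpectrum (𝓞 ℚ)) : PadicAlgCl 2)⁻¹) ^ (k v)) * algebraMap ℚ (PadicAlgCl 2) (ratPlusSymbol f (x₀ * ((∏ v : S₀, Rat.HeightOneSpectrum.natGenerator (v : HeightOneSpectrum (𝓞 ℚ)) ^ (k v) : ℕ) : ℚ))))‖ = 1) :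
∀ (E : WeierstrassCurve ℚ) [E.IsElliptic] [E.IsGloballyMinimal], GoodSS E 2 → E.frobeniusTrace 2 = 0 →
    ∀ [NeZero (E.conductorNorm ℤ)] (f : CuspForm (Gamma0 (E.conductorNorm ℤ)) 2), IsNewformOf E f →
    ∀ (ϖ : ℚ), (ϖ : ℝ) * E.realPeriodRat = plusPeriod f →
    ∀ (S₀ : Finset (HeightOneSpectrum (𝓞 ℚ))), (∀ v ∈ S₀, ((2 : ℕ) : 𝓞 ℚ) ∉ v.asIdeal) →
      (∀ v : HeightOneSpectrum (𝓞 ℚ), ¬ E.HasGoodReductionAt v → v ∈ S₀) →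
    ∃ x₀ : ℚ, ‖algebraMap ℚ (PadicAlgCl 2) (2 * ϖ) * (∑ k ∈ Fintype.piFinset (fun _ : S₀ ↦ Finset.range 3), (∏ v : S₀, ((E.localPolynomialAt (v : HeightOneSpectrum (𝓞 ℚ))).map (Int.castRingHom (PadicAlgCl 2))).coeff (k v) * ((Rat.HeightOneSpectrum.natGenerator (v : HeightOneSpectrum (𝓞 ℚ)) : PadicAlgCl 2)⁻¹) ^ (k v)) * algebraMap ℚ (PadicAlgCl 2) (ratPlusSymbol f (x₀ * ((∏ v : S₀, Rat.HeightOneSpectrum.natGenerator (v : HeightOneSpectrum (𝓞 ℚ)) ^ (k v) : ℕ) : ℚ))))‖ = 1 := by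
  intro E _ _ hss ha _ f hf ϖ hϖ S₀ hS2 hSE
  obtain ⟨x₀, -, hx₀⟩ := Hμ E hss ha f hf ϖ hϖ S₀ hS2 hSE
  exact ⟨x₀, hx₀⟩

end Compare

/-! ## §6. Appended (lead g11, same gen): the `Δ < 0` (absolutely irreducible) forms — what skeleton `symbol` v6 binds -/

section CruxNegDisc

/-- **`MazurTateCongruenceAtTwoTop` BY NAME from PUB⁴ + the period fact + (DU₂⁻)** — (DU₂) asked only of curves with `Δ < 0`
(on the theta habitat BOTH curves have `Δ < 0`: `W` by `habitatNegDisc`, the CM partner `A` by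
`ThetaPartnerXRoute.Δ_neg_of_hasCM_of_goodSS_two`). Pointwise through `mazurTateCongruence_of_plusLine` with the four-fact plus line.
BSD is not proved by this. [cite: GreenbergVatsal2000, Thm. (1.4), §3 (13)] [cite: Buzzard2000LevelLoweringModTwo, Prop. 2.4] -/
theorem mazurTateCongruenceAtTwoTop_of_fourFacts_depletedUnitNegDisc
    (hES : eichlerShimura_depletedOptimalQuotient_periodLattice_of_dvd) (hSD : heckeSelfDual_torsionBy_J0)
    (hBz : buzzard2000_multiplicityOne_gamma0) (hSe : serre1972_supersingular_decompositionSubgroup_image)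
    (h2 : realPeriodRat_eq_unit_mul_plusPeriod_two)
    (hDU : ∀ (E : WeierstrassCurve ℚ) [E.IsElliptic] [E.IsGloballyMinimal], GoodSS E 2 → E.frobeniusTrace 2 = 0 → E.Δ < 0 →
      ∀ [NeZero (E.conductorNorm ℤ)] (f : CuspForm (Gamma0 (E.conductorNorm ℤ)) 2), IsNewformOf E f →
      ∀ (ϖ : ℚ), (ϖ : ℝ) * E.realPeriodRat = plusPeriod f →
      ∀ (S₀ : Finset (HeightOneSpectrum (𝓞 ℚ))), (∀ v ∈ S₀, ((2 : ℕ) : 𝓞 ℚ) ∉ v.asIdeal) →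
        (∀ v : HeightOneSpectrum (𝓞 ℚ), ¬ E.HasGoodReductionAt v → v ∈ S₀) →
      ∃ x₀ : ℚ, ‖algebraMap ℚ (PadicAlgCl 2) (2 * ϖ) * (∑ k ∈ Fintype.piFinset (fun _ : S₀ ↦ Finset.range 3), (∏ v : S₀, ((E.localPolynomialAt (v : HeightOneSpectrum (𝓞 ℚ))).map (Int.castRingHom (PadicAlgCl 2))).coeff (k v) * ((Rat.HeightOneSpectrum.natGenerator (v : HeightOneSpectrum (𝓞 ℚ)) : PadicAlgCl 2)⁻¹) ^ (k v)) * algebraMap ℚ (PadicAlgCl 2) (ratPlusSymbol f (x₀ * ((∏ v : S₀, Rat.HeightOneSpectrum.natGenerator (v : HeightOneSpectrum (𝓞 ℚ)) ^ (k v) : ℕ) : ℚ))))‖ = 1) :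
    Summit.BirchSwinnertonDyer.BirchSwinnertonDyer.Theses.ThetaPartnerAtTwo.MazurTateCongruenceAtTwoTop := by
  intro W _ _ A _ _ _ _ hss ha hAcm hAss hAa he γ _ _ f hf ϖ hϖ Lplus Lminus hPP _ fA hfA ϖA hϖA LplusA LminusA hPPA
    S₀ hS2 hSW hSA G m hG GA m' hGA
  have hΔ : W.Δ < 0 := by
    obtain ⟨e, he'⟩ := he
    exact ThetaPartnerXRoute.Δ_neg_of_cmPartner_two W A hAcm hAss e he'
  have hΔA : A.Δ < 0 := ThetaPartnerXRoute.Δ_neg_of_hasCM_of_goodSS_two A hAcm hAss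
  exact mazurTateCongruence_of_plusLine W A (plusLineAtTwoLevel_of_charTwoLevel (plusLineCharTwo_of_fourFacts hES hSD hBz hSe))
    hss hΔ hAss he f hf ϖ hPP fA hfA ϖA hPPA S₀ hS2 hSW hSA
    (symbolMu_of_exists_depletedUnit W h2 hss ha hf hϖ S₀ hS2 (hDU W hss ha hΔ f hf ϖ hϖ S₀ hS2 hSW))
    (symbolMu_of_exists_depletedUnit A h2 hAss hAa hfA hϖA S₀ hS2 (hDU A hAss hAa hΔA fA hfA ϖA hϖA S₀ hS2 hSA)) hG hGA

/-- **`MazurTateCongruenceAtTwoTop` BY NAME from PUB⁴ + the period fact + (DP₂⁻) «depletion preserves primitivity, for `Δ < 0`»** —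
the binder of skeleton `symbol` v6 (`stub_depletionPrimitiveNegDisc_of_ihara` supplies (DP₂⁻) from the period fact and the Ihara-type
statement (IH₂⁻) for ABSOLUTELY irreducible `E[2]`). BSD is not proved by this. [cite: Ribet1984ICM, Thm. 4.3]
[cite: GreenbergVatsal2000, §3 (13) and Remark 3.4] -/
theorem mazurTateCongruenceAtTwoTop_of_fourFacts_depletionPrimitiveNegDisc
    (hES : eichlerShimura_depletedOptimalQuotient_periodLattice_of_dvd) (hSD : heckeSelfDual_torsionBy_J0)
    (hBz : buzzard2000_multiplicityOne_gamma0) (hSe : serre1972_supersingular_decompositionSubgroup_image)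
    (h2 : realPeriodRat_eq_unit_mul_plusPeriod_two)
    (hDP : ∀ (E : WeierstrassCurve ℚ) [E.IsElliptic] [E.IsGloballyMinimal], GoodSS E 2 → E.frobeniusTrace 2 = 0 → E.Δ < 0 →
      ∀ [NeZero (E.conductorNorm ℤ)] (f : CuspForm (Gamma0 (E.conductorNorm ℤ)) 2), IsNewformOf E f →
      ∀ (ϖ : ℚ), (ϖ : ℝ) * E.realPeriodRat = plusPeriod f →
      ∀ (S₀ : Finset (HeightOneSpectrum (𝓞 ℚ))), (∀ v ∈ S₀, ((2 : ℕ) : 𝓞 ℚ) ∉ v.asIdeal) →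
        (∀ v : HeightOneSpectrum (𝓞 ℚ), ¬ E.HasGoodReductionAt v → v ∈ S₀) →
      (∃ r : ℚ, ‖algebraMap ℚ (PadicAlgCl 2) (2 * ϖ) * algebraMap ℚ (PadicAlgCl 2) (ratPlusSymbol f r)‖ = 1) →
      ∃ x₀ : ℚ, ‖algebraMap ℚ (PadicAlgCl 2) (2 * ϖ) * (∑ k ∈ Fintype.piFinset (fun _ : S₀ ↦ Finset.range 3), (∏ v : S₀, ((E.localPolynomialAt (v : HeightOneSpectrum (𝓞 ℚ))).map (Int.castRingHom (PadicAlgCl 2))).coeff (k v) * ((Rat.HeightOneSpectrum.natGenerator (v : HeightOneSpectrum (𝓞 ℚ)) : PadicAlgCl 2)⁻¹) ^ (k v)) * algebraMap ℚ (PadicAlgCl 2) (ratPlusSymbol f (x₀ * ((∏ v : S₀, Rat.HeightOneSpectrum.natGenerator (v : HeightOneSpectrum (𝓞 ℚ)) ^ (k v) : ℕ) : ℚ))))‖ = 1) :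
    Summit.BirchSwinnertonDyer.BirchSwinnertonDyer.Theses.ThetaPartnerAtTwo.MazurTateCongruenceAtTwoTop := by
  refine mazurTateCongruenceAtTwoTop_of_fourFacts_depletedUnitNegDisc hES hSD hBz hSe h2 ?_
  intro E _ _ hss ha hΔ _ f hf ϖ hϖ S₀ hS2 hSE
  exact hDP E hss ha hΔ f hf ϖ hϖ S₀ hS2 hSE (exists_undepletedUnit E h2 hss hf hϖ)

/-- **PUB⁵ form** (period fact from Abbes–Ullmo Thm. A) of the preceding theorem. BSD is not proved by this. [cite: AbbesUllmo1996, Thm. A]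
[cite: Ribet1984ICM, Thm. 4.3] -/
theorem mazurTateCongruenceAtTwoTop_of_fiveFacts_depletionPrimitiveNegDisc
    (hES : eichlerShimura_depletedOptimalQuotient_periodLattice_of_dvd) (hSD : heckeSelfDual_torsionBy_J0)
    (hBz : buzzard2000_multiplicityOne_gamma0) (hSe : serre1972_supersingular_decompositionSubgroup_image)
    (hAU : abbesUllmo_not_dvd_maninConstant_of_not_dvd_level)
    (hDP : ∀ (E : WeierstrassCurve ℚ) [E.IsElliptic] [E.IsGloballyMinimal], GoodSS E 2 → E.frobeniusTrace 2 = 0 → E.Δ < 0 →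
      ∀ [NeZero (E.conductorNorm ℤ)] (f : CuspForm (Gamma0 (E.conductorNorm ℤ)) 2), IsNewformOf E f →
      ∀ (ϖ : ℚ), (ϖ : ℝ) * E.realPeriodRat = plusPeriod f →
      ∀ (S₀ : Finset (HeightOneSpectrum (𝓞 ℚ))), (∀ v ∈ S₀, ((2 : ℕ) : 𝓞 ℚ) ∉ v.asIdeal) →
        (∀ v : HeightOneSpectrum (𝓞 ℚ), ¬ E.HasGoodReductionAt v → v ∈ S₀) →
      (∃ r : ℚ, ‖algebraMap ℚ (PadicAlgCl 2) (2 * ϖ) * algebraMap ℚ (PadicAlgCl 2) (ratPlusSymbol f r)‖ = 1) →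
      ∃ x₀ : ℚ, ‖algebraMap ℚ (PadicAlgCl 2) (2 * ϖ) * (∑ k ∈ Fintype.piFinset (fun _ : S₀ ↦ Finset.range 3), (∏ v : S₀, ((E.localPolynomialAt (v : HeightOneSpectrum (𝓞 ℚ))).map (Int.castRingHom (PadicAlgCl 2))).coeff (k v) * ((Rat.HeightOneSpectrum.natGenerator (v : HeightOneSpectrum (𝓞 ℚ)) : PadicAlgCl 2)⁻¹) ^ (k v)) * algebraMap ℚ (PadicAlgCl 2) (ratPlusSymbol f (x₀ * ((∏ v : S₀, Rat.HeightOneSpectrum.natGenerator (v : HeightOneSpectrum (𝓞 ℚ)) ^ (k v) : ℕ) : ℚ))))‖ = 1) :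
    Summit.BirchSwinnertonDyer.BirchSwinnertonDyer.Theses.ThetaPartnerAtTwo.MazurTateCongruenceAtTwoTop :=
  mazurTateCongruenceAtTwoTop_of_fourFacts_depletionPrimitiveNegDisc hES hSD hBz hSe
    (SkinnerUrban2014.realPeriodRat_eq_unit_mul_plusPeriod_two_fact_of_abbesUllmo hAU) hDP

/-- The twin `MazurTateCongruenceAtTwoR` (stmt-21416) BY NAME from PUB⁴ + the period fact + (DP₂⁻). BSD is not proved by this.
[cite: Ribet1984ICM, Thm. 4.3] [cite: GreenbergVatsal2000, §3 (13)] -/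
theorem mazurTateCongruenceAtTwoR_of_fourFacts_depletionPrimitiveNegDisc
    (hES : eichlerShimura_depletedOptimalQuotient_periodLattice_of_dvd) (hSD : heckeSelfDual_torsionBy_J0)
    (hBz : buzzard2000_multiplicityOne_gamma0) (hSe : serre1972_supersingular_decompositionSubgroup_image)
    (h2 : realPeriodRat_eq_unit_mul_plusPeriod_two)
    (hDP : ∀ (E : WeierstrassCurve ℚ) [E.IsElliptic] [E.IsGloballyMinimal], GoodSS E 2 → E.frobeniusTrace 2 = 0 → E.Δ < 0 →
      ∀ [NeZero (E.conductorNorm ℤ)] (f : CuspForm (Gamma0 (E.conductorNorm ℤ)) 2), IsNewformOf E f →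
      ∀ (ϖ : ℚ), (ϖ : ℝ) * E.realPeriodRat = plusPeriod f →
      ∀ (S₀ : Finset (HeightOneSpectrum (𝓞 ℚ))), (∀ v ∈ S₀, ((2 : ℕ) : 𝓞 ℚ) ∉ v.asIdeal) →
        (∀ v : HeightOneSpectrum (𝓞 ℚ), ¬ E.HasGoodReductionAt v → v ∈ S₀) →
      (∃ r : ℚ, ‖algebraMap ℚ (PadicAlgCl 2) (2 * ϖ) * algebraMap ℚ (PadicAlgCl 2) (ratPlusSymbol f r)‖ = 1) →
      ∃ x₀ : ℚ, ‖algebraMap ℚ (PadicAlgCl 2) (2 * ϖ) * (∑ k ∈ Fintype.piFinset (fun _ : S₀ ↦ Finset.range 3), (∏ v : S₀, ((E.localPolynomialAt (v : HeightOneSpectrum (𝓞 ℚ))).map (Int.castRingHom (PadicAlgCl 2))).coeff (k v) * ((Rat.HeightOneSpectrum.natGenerator (v : HeightOneSpectrum (𝓞 ℚ)) : PadicAlgCl 2)⁻¹) ^ (k v)) * algebraMap ℚ (PadicAlgCl 2) (ratPlusSymbol f (x₀ * ((∏ v : S₀, Rat.HeightOneSpectrum.natGenerator (v : HeightOneSpectrum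 (𝓞 ℚ)) ^ (k v) : ℕ) : ℚ))))‖ = 1) :
    Summit.BirchSwinnertonDyer.BirchSwinnertonDyer.Theses.ThetaPartnerAtTwo.MazurTateCongruenceAtTwoR :=
  mazurTateCongruenceAtTwoTop_of_fourFacts_depletionPrimitiveNegDisc hES hSD hBz hSe h2 hDP

end CruxNegDisc

end Summit.BirchSwinnertonDyer.BirchSwinnertonDyer.Theorems.MazurTateCongruenceAtTwoR

end
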